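import Summits.CriticalPhenomena.PercolationContinuityZ3.Theorems.SahiMasterFamilyPhiMinClosed

/-!
# Sahi positivity, EVERY order, for "private cores + one common increasing constraint":
# `E_{k+1}(μ_p; 1_{[K_0] ∩ D}, …, 1_{[K_k] ∩ D}) ≥ 0` for pairwise disjoint `K_j` and ANY increasing event `D`

Unit `prim-masterthm-p4` (gen 14; crux anchor stmt-CriticalPhenomena-4575, helper work; memo
`run/shared/lean/prim/prim-masterthm/prim-masterthm-p4/P4-GEN14-REPORT.md` §4).  The event-level payoff of the min-closed theorem
(`…PhiMinClosed`): in the β-normal form of gen 13 (`PrincipalCapBeta.sahiE_ind_eq_mul_phiSet`, `E_{k+1} = (∏_j μ_p[K_j])·Φ_{k+1}(β)`,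
`β_B = μ_p(⋂_{j∈B} U_j)/μ_p[K_B]`) the family `U_j = [K_j] ∩ D` has `β_B = μ_p(D | [K_B])` for `B ≠ ∅`, which is NONDECREASING in `B`
(conditional Harris on the cylinder `[K_B]`: opening more coordinates helps the increasing event `D` — Blinovsky's lemma
`condHarris_ex_ind_cylinder`), hence MIN-CLOSED, so `Φ_{k+1}(β) ≥ 0` by `PhiMinClosed.phiSet_nonneg_of_minClosed`.

**THEOREM** `sahiE_ind_cyl_inter_nonneg` (every order, every product measure on a finite product of two-point spaces): for pairwise
disjoint finite coordinate sets `K_0,…,K_k` and ANY increasing event `D`,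
`E_{k+1}(μ_p; 1_{[K_0]∩D}, …, 1_{[K_k]∩D}) ≥ 0`.
The slots `x ↦ 1_{K_j ⊆ x}·1_D(x)` are in general NOT cumulations (D arbitrary increasing, possibly depending on the cores themselves: e.g.
`D = {at least r coordinates of ⋃K_j open}`, `D` = a crossing event, …), so this class is not covered by Sahi's Theorem 2 [Sahi2008] nor by the
two-free-slots padding theorem [Blinovsky2013] (`FKGCumulation`); `D = univ` gives independent cylinders (`E = 0`), `K_j = ∅` gives the chain
`E_{k+1}(1_D,…,1_D) = d(1−d)⋯(k−d)`.  No principal-cap hypothesis is needed (the min-closed theorem is top-free).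
HONEST FRAMING: a new unconditional stratum of Sahi's `C_k` for product measures, every `k`; Kahn's Conjecture 5 / `C_k` in general and the
master theorem remain OPEN.  Axioms standard. [this work]
-/

noncomputable section

open scoped Classical

namespace Summit.CriticalPhenomena.PercolationContinuityZ3.Theorems

namespace CommonConstraint

open Finset Function MeasureTheory
open Literature.Combinatorics.Sahi2008
open Literature.Probability.Percolation.DecisionTree (ind ind_nonneg)
open PrincipalCapBeta (phiSet cyl coreP mom beta)

variable {ι : Type} [Fintype ι] {k : ℕ}

omit [Fintype ι] in
/-- `⋂_{j∈B} [K_j] = [⋃_{j∈B} K_j]`. [folklore] -/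
theorem biInter_cyl (K : Fin k → Finset ι) (B : Finset (Fin k)) :
    (⋂ j ∈ B, cyl (K j)) = {ω : Set ι | (↑(B.biUnion K) : Set ι) ⊆ ω} := by
  ext ω
  simp only [Set.mem_iInter, PrincipalCapBeta.mem_cyl, Set.mem_setOf_eq, Finset.coe_biUnion, Set.iUnion₂_subset_iff, Finset.mem_coe]

omit [Fintype ι] in
/-- `⋂_{j∈B} ([K_j] ∩ D) = D ∩ [K_B]` for nonempty `B`. [folklore] -/
theorem biInter_cyl_inter (K : Fin k → Finset ι) (D : Set (Set ι)) {B : Finset (Fin k)} (hB : B.Nonempty) :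
    (⋂ j ∈ B, (cyl (K j) ∩ D)) = D ∩ {ω : Set ι | (↑(B.biUnion K) : Set ι) ⊆ ω} := by
  ext ω
  rw [← biInter_cyl]
  simp only [Set.mem_iInter, Set.mem_inter_iff]
  constructor
  · intro h
    obtain ⟨j₀, hj₀⟩ := hB
    exact ⟨(h j₀ hj₀).2, fun j hj => (h j hj).1⟩
  · rintro ⟨hD, h⟩ j hj
    exact ⟨h j hj, hD⟩

/-- **Monotonicity of the conditional moments**: for `∅ ≠ B ⊆ B'` (cores of positive probability),
`μ(D | [K_B]) ≤ μ(D | [K_{B'}])`, i.e. `β_B ≤ β_{B'}` — conditional Harris on the cylinder `[K_B]`. [this work] -/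
theorem beta_mono (p : ι → unitInterval) {K : Fin k → Finset ι} (hdisj : ∀ i j, i ≠ j → Disjoint (K i) (K j))
    (D : Set (Set ι)) (hD : IsUpperSet D) (hpos : ∀ j, coreP p K j ≠ 0) {B B' : Finset (Fin k)} (hB : B.Nonempty) (hBB' : B ⊆ B') :
    beta p (fun j => cyl (K j) ∩ D) K B ≤ beta p (fun j => cyl (K j) ∩ D) K B' := by
  have hB' : B'.Nonempty := hB.mono hBB'
  have hPn : ∀ A : Finset (Fin k), 0 < ∏ j ∈ A, coreP p K j := fun A =>
    lt_of_le_of_ne (prod_nonneg fun j _ => PrincipalCapBeta.coreP_nonneg p K j) (Ne.symm (prod_ne_zero_iff.2 fun j _ => hpos j))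
  -- cylinders and their probabilities
  set C : Set (Set ι) := {ω | (↑(B.biUnion K) : Set ι) ⊆ ω} with hC
  set C' : Set (Set ι) := {ω | (↑(B'.biUnion K) : Set ι) ⊆ ω} with hC'
  have hCup : IsUpperSet C' := PrincipalCapBeta.isUpperSet_cyl _
  have hC'C : C' ⊆ C := fun ω hω => Set.Subset.trans (by
    rw [Finset.coe_subset]; exact Finset.biUnion_subset_biUnion_of_subset_left K hBB') hω
  have hPC : ex (bernoulliWeight p) (ind C) = ∏ j ∈ B, coreP p K j := by
    rw [← PrincipalCapBeta.prod_biUnion_coreP p hdisj]; exact PrincipalCapBeta.ex_ind_cyl p _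
  have hPC' : ex (bernoulliWeight p) (ind C') = ∏ j ∈ B', coreP p K j := by
    rw [← PrincipalCapBeta.prod_biUnion_coreP p hdisj]; exact PrincipalCapBeta.ex_ind_cyl p _
  -- the moments
  have hmB : mom p (fun j => cyl (K j) ∩ D) B = ex (bernoulliWeight p) (ind (D ∩ C)) := by
    unfold PrincipalCapBeta.mom; rw [biInter_cyl_inter K D hB]
  have hmB' : mom p (fun j => cyl (K j) ∩ D) B' = ex (bernoulliWeight p) (ind (D ∩ C')) := by
    unfold PrincipalCapBeta.mom; rw [biInter_cyl_inter K D hB']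
  -- conditional Harris on `C` for `D` and `C'`
  have key := condHarris_ex_ind_cylinder p (↑(B.biUnion K) : Set ι) hD hCup
  have e1 : C' ∩ C = C' := Set.inter_eq_left.2 hC'C
  have e2 : D ∩ C' ∩ C = D ∩ C' := by rw [Set.inter_assoc, e1]
  rw [e1, e2, hPC, hPC'] at key
  change ex (bernoulliWeight p) (ind (D ∩ C)) * (∏ j ∈ B', coreP p K j) ≤ (∏ j ∈ B, coreP p K j) * ex (bernoulliWeight p) (ind (D ∩ C')) at key
  unfold PrincipalCapBeta.beta
  rw [hmB, hmB', div_le_div_iff₀ (hPn B) (hPn B')]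
  calc ex (bernoulliWeight p) (ind (D ∩ C)) * ∏ j ∈ B', coreP p K j
      ≤ (∏ j ∈ B, coreP p K j) * ex (bernoulliWeight p) (ind (D ∩ C')) := key
    _ = ex (bernoulliWeight p) (ind (D ∩ C')) * ∏ j ∈ B, coreP p K j := mul_comm _ _

/-- **THEOREM (every order): `E_{k+1}(μ_p; 1_{[K_0]∩D},…,1_{[K_k]∩D}) ≥ 0`** for pairwise disjoint `K_j` and any increasing event `D`,
every product measure. [this work] -/
theorem sahiE_ind_cyl_inter_nonneg (p : ι → unitInterval) (K : Fin (k + 1) → Finset ι)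
    (hdisj : ∀ i j, i ≠ j → Disjoint (K i) (K j)) (D : Set (Set ι)) (hD : IsUpperSet D) :
    0 ≤ sahiE (bernoulliWeight p) (k + 1) (fun j => ind (cyl (K j) ∩ D)) := by
  have hsub : ∀ j, cyl (K j) ∩ D ⊆ cyl (K j) := fun j => Set.inter_subset_left
  rw [PrincipalCapBeta.sahiE_ind_eq_mul_phiSet p (fun j => cyl (K j) ∩ D) K hdisj hsub]
  by_cases hP : ∏ j, coreP p K j = 0
  · rw [hP, zero_mul]
  · have hpos : ∀ j, coreP p K j ≠ 0 := fun j h0 => hP (prod_eq_zero (mem_univ j) h0)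
    refine mul_nonneg (prod_nonneg fun j _ => PrincipalCapBeta.coreP_nonneg p K j)
      (PhiMinClosed.phiSet_nonneg_of_minClosed _ (PrincipalCapBeta.beta_nonneg p _ K)
        (PrincipalCapBeta.beta_le_one p hdisj hsub) fun S T => ?_)
    -- min-closedness from monotonicity (off the empty set)
    rcases S.eq_empty_or_nonempty with hS | hS
    · rw [hS, empty_union]; exact min_le_right _ _
    rcases T.eq_empty_or_nonempty with hT | hT
    · rw [hT, union_empty]; exact min_le_left _ _
    exact (min_le_left _ _).trans (beta_mono p hdisj D hD hpos hS subset_union_left)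

/-- The same with the common constraint written first: `U_j = D ∩ [K_j]`. [this work] -/
theorem sahiE_ind_inter_cyl_nonneg (p : ι → unitInterval) (K : Fin (k + 1) → Finset ι)
    (hdisj : ∀ i j, i ≠ j → Disjoint (K i) (K j)) (D : Set (Set ι)) (hD : IsUpperSet D) :
    0 ≤ sahiE (bernoulliWeight p) (k + 1) (fun j => ind (D ∩ cyl (K j))) := by
  have e : (fun j => ind (D ∩ cyl (K j))) = fun j => ind (cyl (K j) ∩ D) := funext fun j => by rw [Set.inter_comm]
  rw [e]; exact sahiE_ind_cyl_inter_nonneg p K hdisj D hD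

end CommonConstraint

end Summit.CriticalPhenomena.PercolationContinuityZ3.Theorems
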